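import Mathlib
import Summits.PneNP.PneNP.Theses.AeaCutRectangles

/-!
# IdeasR2s2g9 — first lemmas for the round-2 / seat-2 / gen-9 crux-ideate cards on
# X1 = `AeaCutRectangles.FoolingMeasure` (stmt-PneNP-19727)

Cards: `transversal-portal-skeletons` (§A), `sparse-greenwell-lovasz` (§B), `vortex-window` (§C); §D is a side lemma (RESULTS-r2s2g9 §D).
Frame language as in `IdeasR2s2g8`: reference labelling `r : V → ZMod 3` (the ROW's residues), arcs `u → v` with
`r v = r u + 1`, sites `r u = r v`, colourings `c = r + q`.  Crux workfiles are not importable, so the two g8 lemmas we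
build on (`BiReachable`, `potential_eq_of_biReachable`) are re-proved verbatim.
HONEST FRAMING: finite combinatorics for a FRONTIER restricted-model rung (AEA cut rectangles vs NON-3-COL); nothing here
bears on P versus NP.
-/

set_option linter.dupNamespace false

namespace Summit.PneNP.PneNP.Cruxes.FoolingMeasure.IdeasR2s2g9

open Relation

variable {V : Type*}

/-! ## §A  Alignment-free certain forcing (card `transversal-portal-skeletons`) -/

/-- mutual reachability along the arcs (verbatim from IdeasR2s2g8). -/
def BiReachable (arc : V → V → Prop) (x y : V) : Prop :=
  ReflTransGen arc x y ∧ ReflTransGen arc y x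

theorem potential_eq_of_biReachable (arc : V → V → Prop) (D : V → ℕ)
    (hmono : ∀ u v, arc u v → D u ≤ D v) {x y : V} (h : BiReachable arc x y) : D x = D y := by
  have key : ∀ a b, ReflTransGen arc a b → D a ≤ D b := by
    intro a b hab
    induction hab with
    | refl => exact le_rfl
    | tail _ hbc ih => exact le_trans ih (hmono _ _ hbc)
  exact le_antisymm (key x y h.1) (key y x h.2)

theorem biReachable_mono {arc arc' : V → V → Prop} (hsub : ∀ u v, arc u v → arc' u v) {x y : V}
    (h : BiReachable arc x y) : BiReachable arc' x y := by
  have key : ∀ a b, ReflTransGen arc a b → ReflTransGen arc' a b := by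
    intro a b hab
    induction hab with
    | refl => exact ReflTransGen.refl
    | tail _ hbc ih => exact ih.tail (hsub _ _ hbc)
  exact ⟨key x y h.1, key y x h.2⟩

/-- The PORTAL arcs of a column: its edges `colEdge` with BOTH endpoints in the portal field `Pf`, oriented by the ROW's
residues `r`.  Only `r` restricted to `Pf` is used — no alignment of the column's own frames with the row's is assumed. -/
def portalArc (r : V → ZMod 3) (Pf : Set V) (colEdge : V → V → Prop) (u v : V) : Prop :=
  colEdge u v ∧ u ∈ Pf ∧ v ∈ Pf ∧ r v = r u + 1

/-- TRANSVERSAL (ALIGNMENT-FREE) CERTAIN FORCING.  Row data: residues `r` and arcs `rowArc` frozen on a set containing the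
portal field `Pf`; column data: an arbitrary edge relation `colEdge` (a Bob side from ANY alignment class).  If the site
endpoints `x, y` (`r x = r y`) are mutually reachable through frozen row arcs and portal arcs, then in every hybrid whose
frame digraph `arcH` contains the frozen row arcs and orients column edges inside `Pf` by `r` (which the frame digraph of
`α ∪ β'` w.r.t. the row's residues does by definition), every zero-winding colouring `r + D` (`D` an arc-monotone
ℕ-potential) is improper at the site.  This is `IdeasR2s2g8.junta_forced` with the column arcs restricted to a portal field:
the certificate reads the column only through `Pf`, so it applies to columns of every residue class (EXP-A, RESULTS-r2s2g9 §A). -/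
theorem transversal_forced (r : V → ZMod 3) (Pf : Set V) {rowArc colEdge arcH : V → V → Prop}
    (hF : ∀ u v, rowArc u v → arcH u v)
    (hC : ∀ u v, colEdge u v → u ∈ Pf → v ∈ Pf → r v = r u + 1 → arcH u v)
    (D : V → ℕ) (hmono : ∀ u v, arcH u v → D u ≤ D v) {x y : V} (hsite : r x = r y)
    (hq : BiReachable (fun u v => rowArc u v ∨ portalArc r Pf colEdge u v) x y) :
    r x + (D x : ZMod 3) = r y + (D y : ZMod 3) := by
  have hsub : ∀ u v, (rowArc u v ∨ portalArc r Pf colEdge u v) → arcH u v := by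
    intro u v huv
    rcases huv with h | ⟨hc, hu, hv, hr⟩
    · exact hF u v h
    · exact hC u v hc hu hv hr
  rw [hsite, potential_eq_of_biReachable arcH D hmono (biReachable_mono hsub hq)]

/-! ## §B  Cyclic three-cuts and projection rigidity (card `sparse-greenwell-lovasz`) -/

/-- COMPLETENESS of the three-phase calculus (the converse of `IdeasR2s2g8.phase_steps`): for EVERY proper colouring
`c = r + q` of a frame digraph, the phase steps along arcs are `0` or `+1`; equivalently the phase classes
`Tᵃ = {q = a}` form a CYCLIC THREE-CUT: no arc `T¹ → T⁰`, `T⁰ → T²`, `T² → T¹`. -/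
theorem phase_step_of_proper (r q : V → ZMod 3) {u v : V} (harc : r v = r u + 1)
    (hprop : r u + q u ≠ r v + q v) : q v = q u ∨ q v = q u + 1 := by
  rw [harc] at hprop
  have key : ∀ a b c : ZMod 3, c + a ≠ c + 1 + b → (b = a ∨ b = a + 1) := by decide
  exact key (q u) (q v) (r u) hprop

theorem cyclic_threeCut_of_proper (r q : V → ZMod 3) (arc : V → V → Prop)
    (harc : ∀ u v, arc u v → r v = r u + 1) (hprop : ∀ u v, arc u v → r u + q u ≠ r v + q v) :
    ∀ u v, arc u v → (q u = 1 → q v ≠ 0) ∧ (q u = 0 → q v ≠ 2) ∧ (q u = 2 → q v ≠ 1) := by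
  intro u v huv
  have h := phase_step_of_proper r q (harc u v huv) (hprop u v huv)
  have key : ∀ a b : ZMod 3, (b = a ∨ b = a + 1) → (a = 1 → b ≠ 0) ∧ (a = 0 → b ≠ 2) ∧ (a = 2 → b ≠ 1) := by decide
  exact key (q u) (q v) h

/-- Sites must be separated by the cut: at a site (`r u = r v`) a proper colouring has different phases
(verbatim content of `IdeasR2s2g8.site_proper_iff`, one direction). -/
theorem phases_differ_at_site (r q : V → ZMod 3) {u v : V} (hsite : r u = r v)
    (hprop : r u + q u ≠ r v + q v) : q u ≠ q v := by
  intro h; apply hprop; rw [hsite, h]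

/-- THE GREENWELL–LOVÁSZ KERNEL at `t = 2` (checked by `native_decide`): every proper 3-colouring of the categorical
product `K₃ × K₃` (vertices `ZMod 3 × ZMod 3`, adjacent iff BOTH coordinates differ — the ambient graph of a two-frame
hybrid under the residue-vector map) factors through one of the two projections.  Greenwell–Lovász (1974) prove this for
`K_k^{×t}`, all `k ≥ 3`, `t ≥ 1`; the card's crux-level target `SparseGL` asks for the same conclusion, up to site-local
pockets, for the sparse subgraphs of `K₃^{×t}` realised by forced hybrids. -/
theorem greenwellLovasz_K3_sq :
    ∀ g : ZMod 3 × ZMod 3 → ZMod 3,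
      (∀ x y : ZMod 3 × ZMod 3, x.1 ≠ y.1 → x.2 ≠ y.2 → g x ≠ g y) →
        (∀ x y : ZMod 3 × ZMod 3, x.1 = y.1 → g x = g y) ∨ (∀ x y : ZMod 3 × ZMod 3, x.2 = y.2 → g x = g y) := by
  native_decide

/-- The crux-level transfer target of the card, typed over an abstract finite vertex set: `SparseGL` for a hybrid given by
residue maps `res k : V → ZMod 3` (`k < t`), an edge relation `E` avoiding every diagonal except on a site set, and a
"pocket budget" `L`: every proper 3-colouring agrees with `± res k + κ` off a set of size `≤ L`, for some frame `k`. -/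
def SparseGL (t : ℕ) (V : Type*) [Fintype V] [DecidableEq V] (res : Fin t → V → ZMod 3)
    (E : V → V → Prop) (L : ℕ) : Prop :=
  ∀ c : V → ZMod 3, (∀ u v, E u v → c u ≠ c v) →
    ∃ (k : Fin t) (ε : ZMod 3) (κ : ZMod 3), ε ≠ 0 ∧
      ∃ S : Finset V, S.card ≤ L ∧ ∀ v, v ∉ S → c v = ε * res k v + κ

/-! ## §C  Flip regions and the vortex window (card `vortex-window`) -/

/-- FLIP-BOUNDARY CRITERION.  A region coloured by the sign-flipped frame `-r + κ` can sit next to the frame region `r + κ'` across an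
arc `u → v` (`r v = r u + 1`, `u` inside) iff the inside endpoint AVOIDS one residue class: `r u ≠ 2(κ - κ' - 1)`.  So flip regions —
the non-zero-winding features a portal certificate cannot kill — are bounded by residue-avoiding vertex sets, cheap exactly at
degree-starved vertices; this is the combinatorial content of the freezing count `3·(2/3)^{d_A}` in the card. -/
theorem flip_boundary_iff (r : V → ZMod 3) (κ κ' : ZMod 3) {u v : V} (harc : r v = r u + 1) :
    (-r u + κ ≠ r v + κ') ↔ r u ≠ 2 * (κ - κ' - 1) := by
  rw [harc]
  have key : ∀ a b c : ZMod 3, (-a + b ≠ a + 1 + c) ↔ a ≠ 2 * (b - c - 1) := by decide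
  exact key (r u) κ κ'

/-- the same across an arc `v → u` entering the flip region (`r u = r v + 1`, `u` inside): `r u ≠ 2(κ - κ' + 1)`. -/
theorem flip_boundary_iff' (r : V → ZMod 3) (κ κ' : ZMod 3) {u v : V} (harc : r u = r v + 1) :
    (-r u + κ ≠ r v + κ') ↔ r u ≠ 2 * (κ - κ' + 1) := by
  have hv : r v = r u - 1 := by rw [harc]; ring
  rw [hv]
  have key : ∀ a b c : ZMod 3, (-a + b ≠ a - 1 + c) ↔ a ≠ 2 * (b - c + 1) := by decide
  exact key (r u) κ κ'

/-! ## §D  Side lemma: the forest-straddle SPLIT LEMMA (RESULTS-r2s2g9 §D) -/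

/-- SPLIT LEMMA (proved on paper in RESULTS §D via 2-choosability of forests; typed here):
if the edges of a graph on `Fin n` are covered by a forest `FB` living inside `B = Aᶜ` and a forest `FA` each of whose
edges meets `A`, the graph is 3-colourable.  Consequence: a dark hybrid `α ∪ β'` has NO 4-critical witness whose
row piece (edges meeting Alice's side) and column piece (edges inside `B`) are both forests — straddling darkness
certificates need cycles (≥ 1 in the column piece or ≥ 2 in the row piece), hence have ≥ girth many vertices. -/
def SplitLemma : Prop :=
  ∀ (n : ℕ) (A : Finset (Fin n)) (FA FB : SimpleGraph (Fin n)),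
    FA.IsAcyclic → FB.IsAcyclic →
    (∀ u v, FB.Adj u v → u ∉ A ∧ v ∉ A) →
    (∀ u v, FA.Adj u v → u ∈ A ∨ v ∈ A) →
    (FA ⊔ FB).Colorable 3

/-- the odd wheel `W₅`: hub `0`, rim `1 … 5` (as a relation on `Fin 6`). -/
def wheelRel (i j : Fin 6) : Prop := (i = 0 ∧ j ≠ 0) ∨ (i ≠ 0 ∧ j ≠ 0 ∧ j.val = i.val % 5 + 1)

instance : DecidableRel wheelRel := fun i j => by unfold wheelRel; infer_instance

/-- The smallest straddling certificate that the split lemma allows: an odd wheel `W₅` with hub on Alice's side and rim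
inside `B` (row piece = star = tree, column piece = `C₅`, one cycle).  Non-3-colourability checked by `native_decide`. -/
theorem wheel5_not_colorable : ¬ (SimpleGraph.fromRel wheelRel).Colorable 3 := by
  intro h
  obtain ⟨C⟩ := h
  have key : ∀ f : Fin 6 → Fin 3, ∃ i j : Fin 6, (i ≠ j ∧ (wheelRel i j ∨ wheelRel j i)) ∧ f i = f j := by
    native_decide
  obtain ⟨i, j, hij, hfij⟩ := key C
  exact C.valid (by rw [SimpleGraph.fromRel_adj]; exact hij) hfij

end Summit.PneNP.PneNP.Cruxes.FoolingMeasure.IdeasR2s2g9
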